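import Literature.Analysis.FluidPDE.NewtonKernel
import Mathlib.Analysis.Calculus.ParametricIntegral
import Mathlib.MeasureTheory.Integral.Bochner.ContinuousLinearMap
import HarnessLib

/-!
# Smoothness, with all-orders bounds, of integrals of smooth kernels against integrable
# densities; iterated derivatives of homogeneous kernels

Analysis/FluidPDE support file (everything proved, no definitions, no named facts) for the
discharge of the named fact `Literature.Analysis.FluidPDE.jia_sverak_2014_local_higher_regularity`
(`JiaSverak2014LocalRegularity.lean`; H. Jia, V. Šverák, Invent. Math. 196 (2014) =
arXiv:1204.0529, §4 proof of Thm. 4.1, the bootstrapping: the parts of the pressure generated by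
the velocity away from the ball under consideration — the off-support part of the local pressure
and the far-field pressure `p_far` of the local pressure expansion (3.3) — are smooth near the
ball with all derivatives controlled by the local energy). Two generic tools:

* `contDiffOn_integral_kernel`, `iteratedFDeriv_integral_kernel`,
  `norm_iteratedFDeriv_integral_kernel_le`, `kernel_hyps_comp_sub` — for a kernel `K(x, y)` which is smooth in `x` on an
  open set `U` for every `y` in a set `S` of full measure, with
  `‖Dₓᵐ K(x, y)‖ ≤ B(m) w(y)` there and `∫ w |g| < ∞`, the integral `V(x) = ∫ g(y) K(x, y) dy` is
  smooth on `U` with `Dᵐ V(x) = ∫ g(y) Dₓᵐ K(x, y) dy` and `‖DᵐV(x)‖ ≤ B(m) ∫ w|g|`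
  (differentiation under the integral sign, Mathlib's
  `hasFDerivAt_integral_of_dominated_of_fderiv_le`, iterated over the order with the density's
  value space changing; the all-orders form of the tree's `HarmonicProbe` /
  `NormalisedPressureFarFieldHessian` computations);
* `iteratedFDeriv_homogeneous`, `exists_norm_iteratedFDeriv_le_of_homogeneous` — a function
  homogeneous of integer degree `d` and smooth off the origin has `Dᵐ` homogeneous of degree
  `d − m`, hence `‖DᵐΦ(z)‖ ≤ C(m) ‖z‖^{d−m}` (the tree's `fderiv_homogeneous`, iterated).

## Mathlib / tree search

Mathlib (used): `hasFDerivAt_integral_of_dominated_of_fderiv_le`,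
`contDiffOn_succ_iff_fderiv_of_isOpen`, `ContDiffOn.fderiv_of_isOpen`,
`iteratedFDeriv_succ_eq_comp_right`, `iteratedFDeriv_succ_eq_comp_left`,
`norm_iteratedFDeriv_fderiv`, `Filter.EventuallyEq.iteratedFDeriv`,
`ContinuousLinearEquiv.integral_comp_comm`. Tree: `fderiv_homogeneous` (`NewtonKernel`).

## References

* H. Jia, V. Šverák, Invent. Math. 196 (2014) = arXiv:1204.0529, §3 (3.3), §4 proof of Thm. 4.1.
  Bib key `JiaSverak2014`.
* D. Gilbarg, N. S. Trudinger, *Elliptic Partial Differential Equations of Second Order* (2001),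
  Lemma 4.1 and Thm. 2.10 (interior derivative estimates). Bib key `GilbargTrudinger2001`.
-/

noncomputable section

open MeasureTheory Set Function Filter Metric
open _root_.Topology
open scoped NNReal ENNReal ContDiff

universe u

namespace Literature.Analysis.FluidPDE

/-- Local notation for physical space `ℝ³ = EuclideanSpace ℝ (Fin 3)`. -/
local notation "ℝ³" => EuclideanSpace ℝ (Fin 3)

/-! ### Currying identities for iterated derivatives -/

section Curry

variable {F : Type*} [NormedAddCommGroup F] [NormedSpace ℝ F]

/-- `Dᵐ(Df)(x)` is the image of `Dᵐ⁺¹f(x)` under the currying isometry. [folklore] -/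
theorem iteratedFDeriv_fderiv_eq_curry (m : ℕ) (f : ℝ³ → F) (x : ℝ³) :
    iteratedFDeriv ℝ m (fderiv ℝ f) x =
      (continuousMultilinearCurryRightEquiv' ℝ m ℝ³ F) (iteratedFDeriv ℝ (m + 1) f x) := by
  have h : iteratedFDeriv ℝ (m + 1) f x =
      (continuousMultilinearCurryRightEquiv' ℝ m ℝ³ F).symm (iteratedFDeriv ℝ m (fderiv ℝ f) x) :=
    iteratedFDeriv_succ_eq_comp_right
  rw [h, LinearIsometryEquiv.apply_symm_apply]

/-- `f(x)` is the image of `D⁰f(x)` under the `Fin 0` currying isometry. [folklore] -/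
theorem eq_curry0_iteratedFDeriv_zero (f : ℝ³ → F) (x : ℝ³) :
    f x = (continuousMultilinearCurryFin0 ℝ ℝ³ F) (iteratedFDeriv ℝ 0 f x) := by
  simp

end Curry

/-! ### Differentiation under the integral sign, all orders -/

section Kernel

variable {U S : Set ℝ³} {μ : Measure ℝ³} {g : ℝ³ → ℝ} {w : ℝ³ → ℝ}

/-! The standing hypotheses on a kernel `K : ℝ³ → ℝ³ → F` (`x`, then `y`) are, throughout:
(h1) `∀ y ∈ S, ContDiffOn ℝ ∞ (fun x => K x y) U` — smooth in `x` on the open set `U`;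
(h2) `∀ m, ∀ x ∈ U, ∀ y ∈ S, ‖iteratedFDeriv ℝ m (fun x' => K x' y) x‖ ≤ B m * w y` — weighted
bounds of all `x`-derivatives; (h3) `∀ m, ∀ x ∈ U, AEStronglyMeasurable (fun y => Dₓᵐ K(x, y)) μ`.
They pass to the derivative kernel `DₓK` with `B` shifted by one. -/

variable {F : Type u} [NormedAddCommGroup F] [NormedSpace ℝ F]

/-- (h1) passes to the derivative kernel. [folklore] -/
theorem kernel_h1_fderiv {K : ℝ³ → ℝ³ → F} (hU : IsOpen U)
    (h1 : ∀ y ∈ S, ContDiffOn ℝ ∞ (fun x => K x y) U) :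
    ∀ y ∈ S, ContDiffOn ℝ ∞ (fun x => fderiv ℝ (fun x' => K x' y) x) U := fun y hy =>
  (h1 y hy).fderiv_of_isOpen hU (by exact_mod_cast le_top)

/-- (h2) passes to the derivative kernel with `B(m+1)`. [folklore] -/
theorem kernel_h2_fderiv {K : ℝ³ → ℝ³ → F} {B : ℕ → ℝ}
    (h2 : ∀ m : ℕ, ∀ x ∈ U, ∀ y ∈ S, ‖iteratedFDeriv ℝ m (fun x' => K x' y) x‖ ≤ B m * w y) :
    ∀ m : ℕ, ∀ x ∈ U, ∀ y ∈ S,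
      ‖iteratedFDeriv ℝ m (fun x' => fderiv ℝ (fun x'' => K x'' y) x') x‖ ≤ B (m + 1) * w y := by
  intro m x hx y hy
  rw [show (fun x' => fderiv ℝ (fun x'' => K x'' y) x') = fderiv ℝ (fun x'' => K x'' y) from rfl,
    norm_iteratedFDeriv_fderiv]
  exact h2 (m + 1) x hx y hy

/-- (h3) passes to the derivative kernel. [folklore] -/
theorem kernel_h3_fderiv {K : ℝ³ → ℝ³ → F}
    (h3 : ∀ m : ℕ, ∀ x ∈ U, AEStronglyMeasurable (fun y => iteratedFDeriv ℝ m (fun x' => K x' y) x) μ) :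
    ∀ m : ℕ, ∀ x ∈ U, AEStronglyMeasurable
      (fun y => iteratedFDeriv ℝ m (fun x' => fderiv ℝ (fun x'' => K x'' y) x') x) μ := by
  intro m x hx
  have e : (fun y => iteratedFDeriv ℝ m (fun x' => fderiv ℝ (fun x'' => K x'' y) x') x) =
      fun y => (continuousMultilinearCurryRightEquiv' ℝ m ℝ³ F)
        (iteratedFDeriv ℝ (m + 1) (fun x' => K x' y) x) := by
    funext y
    exact iteratedFDeriv_fderiv_eq_curry m (fun x' => K x' y) x
  rw [e]
  exact (continuousMultilinearCurryRightEquiv' ℝ m ℝ³ F).continuous.comp_aestronglyMeasurable (h3 (m + 1) x hx)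

/-- Measurability of `y ↦ K(x, y)` from (h3) at order `0`. [folklore] -/
theorem kernel_aestronglyMeasurable_zero {K : ℝ³ → ℝ³ → F}
    (h3 : ∀ m : ℕ, ∀ x ∈ U, AEStronglyMeasurable (fun y => iteratedFDeriv ℝ m (fun x' => K x' y) x) μ)
    {x : ℝ³} (hx : x ∈ U) : AEStronglyMeasurable (fun y => K x y) μ := by
  have e : (fun y => K x y) =
      fun y => (continuousMultilinearCurryFin0 ℝ ℝ³ F) (iteratedFDeriv ℝ 0 (fun x' => K x' y) x) := by
    funext y; exact eq_curry0_iteratedFDeriv_zero (fun x' => K x' y) x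
  rw [e]
  exact (continuousMultilinearCurryFin0 ℝ ℝ³ F).continuous.comp_aestronglyMeasurable (h3 0 x hx)

/-- The order-zero bound `‖K(x, y)‖ ≤ B(0) w(y)` from (h2). [folklore] -/
theorem kernel_norm_zero_le {K : ℝ³ → ℝ³ → F} {B : ℕ → ℝ}
    (h2 : ∀ m : ℕ, ∀ x ∈ U, ∀ y ∈ S, ‖iteratedFDeriv ℝ m (fun x' => K x' y) x‖ ≤ B m * w y)
    {x : ℝ³} (hx : x ∈ U) {y : ℝ³} (hy : y ∈ S) : ‖K x y‖ ≤ B 0 * w y := by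
  have := h2 0 x hx y hy
  rwa [norm_iteratedFDeriv_zero] at this

/-- **One derivative under the integral sign.** Under (h1)–(h3), with `S` of full `μ`-measure,
`g` measurable, `w ≥ 0` and `∫ w|g| dμ < ∞`: at every `x ∈ U`, `V(x) = ∫ g(y) • K(x,y) dμ(y)`
has the Fréchet derivative `∫ g(y) • DₓK(x,y) dμ(y)`. [folklore] -/
theorem hasFDerivAt_integral_kernel {K : ℝ³ → ℝ³ → F} {B : ℕ → ℝ} (hU : IsOpen U)
    (hS : ∀ᵐ y ∂μ, y ∈ S) (h1 : ∀ y ∈ S, ContDiffOn ℝ ∞ (fun x => K x y) U)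
    (h2 : ∀ m : ℕ, ∀ x ∈ U, ∀ y ∈ S, ‖iteratedFDeriv ℝ m (fun x' => K x' y) x‖ ≤ B m * w y)
    (h3 : ∀ m : ℕ, ∀ x ∈ U, AEStronglyMeasurable (fun y => iteratedFDeriv ℝ m (fun x' => K x' y) x) μ)
    (hg : AEStronglyMeasurable g μ) (hw0 : ∀ y, 0 ≤ w y) (hwg : Integrable (fun y => w y * ‖g y‖) μ)
    {x : ℝ³} (hx : x ∈ U) :
    HasFDerivAt (fun x' => ∫ y, g y • K x' y ∂μ)
      (∫ y, g y • fderiv ℝ (fun x' => K x' y) x ∂μ) x := by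
  obtain ⟨ε, hε, hball⟩ := Metric.isOpen_iff.1 hU x hx
  have h2' := kernel_h2_fderiv (U := U) (S := S) (w := w) h2
  have h3' := kernel_h3_fderiv (U := U) (μ := μ) h3
  refine hasFDerivAt_integral_of_dominated_of_fderiv_le
    (F' := fun x' y => g y • fderiv ℝ (fun x'' => K x'' y) x')
    (bound := fun y => |B 1| * (w y * ‖g y‖)) (ball_mem_nhds x hε) ?_ ?_ ?_ ?_ ?_ ?_
  · filter_upwards [ball_mem_nhds x hε] with x' hx'
    exact hg.smul (kernel_aestronglyMeasurable_zero h3 (hball hx'))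
  · -- integrability at `x` from the order-zero bound
    refine Integrable.mono' (hwg.const_mul |B 0|) (hg.smul (kernel_aestronglyMeasurable_zero h3 hx)) ?_
    filter_upwards [hS] with y hy
    rw [norm_smul]
    calc ‖g y‖ * ‖K x y‖ ≤ ‖g y‖ * (B 0 * w y) :=
          mul_le_mul_of_nonneg_left (kernel_norm_zero_le h2 hx hy) (norm_nonneg _)
      _ ≤ ‖g y‖ * (|B 0| * w y) := by gcongr; exacts [hw0 y, le_abs_self _]
      _ = |B 0| * (w y * ‖g y‖) := by ring
  · exact hg.smul (kernel_aestronglyMeasurable_zero h3' hx)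
  · filter_upwards [hS] with y hy x' hx'
    rw [norm_smul]
    have hb := kernel_norm_zero_le h2' (hball hx') hy
    calc ‖g y‖ * ‖fderiv ℝ (fun x'' => K x'' y) x'‖ ≤ ‖g y‖ * (B 1 * w y) :=
          mul_le_mul_of_nonneg_left hb (norm_nonneg _)
      _ ≤ ‖g y‖ * (|B 1| * w y) := by gcongr; exacts [hw0 y, le_abs_self _]
      _ = |B 1| * (w y * ‖g y‖) := by ring
  · exact hwg.const_mul _
  · filter_upwards [hS] with y hy x' hx'
    have hd : DifferentiableAt ℝ (fun x'' => K x'' y) x' :=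
      ((h1 y hy).differentiableOn (by simp)).differentiableAt (hU.mem_nhds (hball hx'))
    exact hd.hasFDerivAt.const_smul (g y)

/-- **Smoothness of kernel integrals on `U`**: under (h1)–(h3) (all orders), `S` of full
measure, `g` measurable, `w ≥ 0` with `∫ w|g| < ∞`, the integral `x ↦ ∫ g(y) • K(x,y) dμ(y)` is `Cⁿ`
on `U` for every `n` (induction on `n`, the derivative being the integral against the derivative
kernel, which satisfies the same hypotheses). [folklore] -/
theorem contDiffOn_integral_kernel (hU : IsOpen U) (hS : ∀ᵐ y ∂μ, y ∈ S)
    (hg : AEStronglyMeasurable g μ) (hw0 : ∀ y, 0 ≤ w y) (hwg : Integrable (fun y => w y * ‖g y‖) μ) :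
    ∀ (n : ℕ) {F : Type u} [NormedAddCommGroup F] [NormedSpace ℝ F] [CompleteSpace F]
      {K : ℝ³ → ℝ³ → F} {B : ℕ → ℝ},
      (∀ y ∈ S, ContDiffOn ℝ ∞ (fun x => K x y) U) →
      (∀ m : ℕ, ∀ x ∈ U, ∀ y ∈ S, ‖iteratedFDeriv ℝ m (fun x' => K x' y) x‖ ≤ B m * w y) →
      (∀ m : ℕ, ∀ x ∈ U, AEStronglyMeasurable (fun y => iteratedFDeriv ℝ m (fun x' => K x' y) x) μ) →
        ContDiffOn ℝ n (fun x => ∫ y, g y • K x y ∂μ) U := by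
  intro n
  induction n with
  | zero =>
    intro F _ _ _ K B h1 h2 h3
    rw [show ((0 : ℕ) : WithTop ℕ∞) = 0 from rfl, contDiffOn_zero]
    intro x hx
    exact (hasFDerivAt_integral_kernel hU hS h1 h2 h3 hg hw0 hwg hx).continuousAt.continuousWithinAt
  | succ n ih =>
    intro F _ _ _ K B h1 h2 h3
    have hD : ∀ x ∈ U, HasFDerivAt (fun x' => ∫ y, g y • K x' y ∂μ)
        (∫ y, g y • fderiv ℝ (fun x' => K x' y) x ∂μ) x := fun x hx =>
      hasFDerivAt_integral_kernel hU hS h1 h2 h3 hg hw0 hwg hx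
    rw [show ((n + 1 : ℕ) : WithTop ℕ∞) = (n : WithTop ℕ∞) + 1 by push_cast; rfl,
      contDiffOn_succ_iff_fderiv_of_isOpen hU]
    refine ⟨fun x hx => (hD x hx).differentiableAt.differentiableWithinAt,
      fun hn => absurd hn (by exact_mod_cast WithTop.natCast_ne_top n), ?_⟩
    have ih' := ih (K := fun x y => fderiv ℝ (fun x' => K x' y) x) (kernel_h1_fderiv hU h1)
      (kernel_h2_fderiv h2) (kernel_h3_fderiv h3)
    refine ih'.congr fun x hx => ?_
    exact (hD x hx).fderiv

/-- **The iterated derivatives of a kernel integral are the integrals of the iterated derivatives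
of the kernel**: `Dᵐ V(x) = ∫ g(y) • Dₓᵐ K(x, y) dμ(y)` for `x ∈ U`. [folklore] -/
theorem iteratedFDeriv_integral_kernel (hU : IsOpen U) (hS : ∀ᵐ y ∂μ, y ∈ S)
    (hg : AEStronglyMeasurable g μ) (hw0 : ∀ y, 0 ≤ w y) (hwg : Integrable (fun y => w y * ‖g y‖) μ) :
    ∀ (m : ℕ) {F : Type u} [NormedAddCommGroup F] [NormedSpace ℝ F] [CompleteSpace F]
      {K : ℝ³ → ℝ³ → F} {B : ℕ → ℝ},
      (∀ y ∈ S, ContDiffOn ℝ ∞ (fun x => K x y) U) →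
      (∀ m : ℕ, ∀ x ∈ U, ∀ y ∈ S, ‖iteratedFDeriv ℝ m (fun x' => K x' y) x‖ ≤ B m * w y) →
      (∀ m : ℕ, ∀ x ∈ U, AEStronglyMeasurable (fun y => iteratedFDeriv ℝ m (fun x' => K x' y) x) μ) →
      ∀ x ∈ U,
        iteratedFDeriv ℝ m (fun x' => ∫ y, g y • K x' y ∂μ) x =
          ∫ y, g y • iteratedFDeriv ℝ m (fun x' => K x' y) x ∂μ := by
  intro m
  induction m with
  | zero =>
    intro F _ _ _ K B h1 h2 h3 x hx
    rw [iteratedFDeriv_zero_eq_comp, Function.comp_apply]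
    have e : (fun y => g y • iteratedFDeriv ℝ 0 (fun x' => K x' y) x) =
        fun y => (continuousMultilinearCurryFin0 ℝ ℝ³ F).symm.toContinuousLinearEquiv (g y • K x y) := by
      funext y
      rw [iteratedFDeriv_zero_eq_comp, Function.comp_apply, ContinuousLinearEquiv.map_smul]
      rfl
    rw [e, ContinuousLinearEquiv.integral_comp_comm]
    rfl
  | succ m ih =>
    intro F _ _ _ K B h1 h2 h3 x hx
    -- `D^{m+1}V = curry⁻¹ ∘ Dᵐ(DV)` and `DV = V_{K'}` near `x`
    have hD : ∀ x' ∈ U, HasFDerivAt (fun x'' => ∫ y, g y • K x'' y ∂μ)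
        (∫ y, g y • fderiv ℝ (fun x'' => K x'' y) x' ∂μ) x' := fun x' hx' =>
      hasFDerivAt_integral_kernel hU hS h1 h2 h3 hg hw0 hwg hx'
    have hev : fderiv ℝ (fun x'' => ∫ y, g y • K x'' y ∂μ) =ᶠ[𝓝 x]
        fun x' => ∫ y, g y • fderiv ℝ (fun x'' => K x'' y) x' ∂μ := by
      filter_upwards [hU.mem_nhds hx] with x' hx'
      exact (hD x' hx').fderiv
    rw [iteratedFDeriv_succ_eq_comp_right, Function.comp_apply,
      (hev.iteratedFDeriv ℝ m).self_of_nhds,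
      ih (K := fun x y => fderiv ℝ (fun x' => K x' y) x) (kernel_h1_fderiv hU h1)
        (kernel_h2_fderiv h2) (kernel_h3_fderiv h3) x hx]
    have e : (fun y => g y • iteratedFDeriv ℝ m (fun x' => fderiv ℝ (fun x'' => K x'' y) x') x) =
        fun y => (continuousMultilinearCurryRightEquiv' ℝ m ℝ³ F).toContinuousLinearEquiv
          (g y • iteratedFDeriv ℝ (m + 1) (fun x' => K x' y) x) := by
      funext y
      rw [ContinuousLinearEquiv.map_smul]
      congr 1
      exact iteratedFDeriv_fderiv_eq_curry m (fun x' => K x' y) x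
    rw [e, ContinuousLinearEquiv.integral_comp_comm]
    change (continuousMultilinearCurryRightEquiv' ℝ m ℝ³ F).symm
        ((continuousMultilinearCurryRightEquiv' ℝ m ℝ³ F)
          (∫ y, g y • iteratedFDeriv ℝ (m + 1) (fun x' => K x' y) x ∂μ)) = _
    rw [LinearIsometryEquiv.symm_apply_apply]

variable [CompleteSpace F]

/-- **All-orders bounds for kernel integrals**: `‖DᵐV(x)‖ ≤ |B(m)| ∫ w|g| dμ` for `x ∈ U`. [folklore] -/
theorem norm_iteratedFDeriv_integral_kernel_le {K : ℝ³ → ℝ³ → F} {B : ℕ → ℝ} (hU : IsOpen U)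
    (hS : ∀ᵐ y ∂μ, y ∈ S) (h1 : ∀ y ∈ S, ContDiffOn ℝ ∞ (fun x => K x y) U)
    (h2 : ∀ m : ℕ, ∀ x ∈ U, ∀ y ∈ S, ‖iteratedFDeriv ℝ m (fun x' => K x' y) x‖ ≤ B m * w y)
    (h3 : ∀ m : ℕ, ∀ x ∈ U, AEStronglyMeasurable (fun y => iteratedFDeriv ℝ m (fun x' => K x' y) x) μ)
    (hg : AEStronglyMeasurable g μ) (hw0 : ∀ y, 0 ≤ w y) (hwg : Integrable (fun y => w y * ‖g y‖) μ)
    (m : ℕ) {x : ℝ³} (hx : x ∈ U) :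
    ‖iteratedFDeriv ℝ m (fun x' => ∫ y, g y • K x' y ∂μ) x‖ ≤ |B m| * ∫ y, w y * ‖g y‖ ∂μ := by
  rw [iteratedFDeriv_integral_kernel hU hS hg hw0 hwg m h1 h2 h3 x hx, ← integral_const_mul]
  refine norm_integral_le_of_norm_le (hwg.const_mul _) ?_
  filter_upwards [hS] with y hy
  rw [norm_smul]
  have hb := h2 m x hx y hy
  calc ‖g y‖ * ‖iteratedFDeriv ℝ m (fun x' => K x' y) x‖ ≤ ‖g y‖ * (B m * w y) :=
        mul_le_mul_of_nonneg_left hb (norm_nonneg _)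
    _ ≤ ‖g y‖ * (|B m| * w y) := by gcongr; exacts [hw0 y, le_abs_self _]
    _ = |B m| * (w y * ‖g y‖) := by ring

/-- The kernel integral is `C^∞` on `U`. [folklore] -/
theorem contDiffOn_infty_integral_kernel {K : ℝ³ → ℝ³ → F} {B : ℕ → ℝ} (hU : IsOpen U)
    (hS : ∀ᵐ y ∂μ, y ∈ S) (h1 : ∀ y ∈ S, ContDiffOn ℝ ∞ (fun x => K x y) U)
    (h2 : ∀ m : ℕ, ∀ x ∈ U, ∀ y ∈ S, ‖iteratedFDeriv ℝ m (fun x' => K x' y) x‖ ≤ B m * w y)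
    (h3 : ∀ m : ℕ, ∀ x ∈ U, AEStronglyMeasurable (fun y => iteratedFDeriv ℝ m (fun x' => K x' y) x) μ)
    (hg : AEStronglyMeasurable g μ) (hw0 : ∀ y, 0 ≤ w y) (hwg : Integrable (fun y => w y * ‖g y‖) μ) :
    ContDiffOn ℝ ∞ (fun x' => ∫ y, g y • K x' y ∂μ) U :=
  contDiffOn_infty.2 fun n => contDiffOn_integral_kernel hU hS hg hw0 hwg n h1 h2 h3

end Kernel

/-! ### Translation kernels `K(x, y) = κ(x − y)` -/

section Translation

variable {F : Type u} [NormedAddCommGroup F] [NormedSpace ℝ F]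

/-- **Translation kernels satisfy the standing hypotheses**: if `κ : ℝ³ → F` is smooth on an open
set `D` containing all differences `x − y`, `x ∈ U`, `y ∈ S`, with
`‖Dᵐκ(x − y)‖ ≤ B(m) w(y)` there, and `Dᵐκ` is continuous on `D`... (the measurability in `y` of
`Dᵐκ(x − ·)` on `S` follows from the continuity of `Dᵐκ` on the open set `D`), then
`K(x, y) = κ(x − y)` satisfies the standing hypotheses (h1)–(h3) for the measure `μ.restrict S`.
[folklore] -/
theorem kernel_hyps_comp_sub {κ : ℝ³ → F} {D U S : Set ℝ³} {μ : Measure ℝ³} {w : ℝ³ → ℝ} {B : ℕ → ℝ}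
    (hD : IsOpen D) (hκ : ContDiffOn ℝ ∞ κ D) (hS : MeasurableSet S)
    (hsub : ∀ x ∈ U, ∀ y ∈ S, x - y ∈ D)
    (hB : ∀ m : ℕ, ∀ x ∈ U, ∀ y ∈ S, ‖iteratedFDeriv ℝ m κ (x - y)‖ ≤ B m * w y) :
    (∀ y ∈ S, ContDiffOn ℝ ∞ (fun x => κ (x - y)) U) ∧
      (∀ m : ℕ, ∀ x ∈ U, ∀ y ∈ S, ‖iteratedFDeriv ℝ m (fun x' => κ (x' - y)) x‖ ≤ B m * w y) ∧
      ∀ m : ℕ, ∀ x ∈ U,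
        AEStronglyMeasurable (fun y => iteratedFDeriv ℝ m (fun x' => κ (x' - y)) x) (μ.restrict S) := by
  have hDm : ∀ m : ℕ, ContinuousOn (iteratedFDeriv ℝ m κ) D := fun m => by
    have := hκ.continuousOn_iteratedFDerivWithin (m := m) (by exact_mod_cast le_top) hD.uniqueDiffOn
    exact this.congr fun z hz => (iteratedFDerivWithin_of_isOpen m hD hz).symm
  refine ⟨fun y hy => ?_, fun m x hx y hy => ?_, fun m x hx => ?_⟩
  · -- smoothness in `x` on `U`
    intro x hx
    have hz : x - y ∈ D := hsub x hx y hy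
    have hat : ContDiffAt ℝ ∞ κ (x - y) := hκ.contDiffAt (hD.mem_nhds hz)
    exact (hat.comp x (contDiffAt_id.sub contDiffAt_const)).contDiffWithinAt
  · rw [iteratedFDeriv_comp_sub]
    exact hB m x hx y hy
  · have e : (fun y => iteratedFDeriv ℝ m (fun x' => κ (x' - y)) x) = fun y => iteratedFDeriv ℝ m κ (x - y) := by
      funext y; exact iteratedFDeriv_comp_sub m y x
    rw [e]
    refine ContinuousOn.aestronglyMeasurable ?_ hS
    exact (hDm m).comp (continuousOn_const.sub continuousOn_id) fun y hy => hsub x hx y hy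

end Translation

/-! ### Iterated derivatives of homogeneous functions -/

section Homogeneous

variable {E : Type*} [NormedAddCommGroup E] [NormedSpace ℝ E]
variable {F : Type*} [NormedAddCommGroup F] [NormedSpace ℝ F]

/-- **Iterated derivatives of a homogeneous function are homogeneous**: if
`Φ(c z) = c^d Φ(z)` for all `c > 0` and all `z` (`d : ℤ`), then
`DᵐΦ(c z) = c^{d−m} DᵐΦ(z)` (the tree's `fderiv_homogeneous`, iterated through
`Dᵐ⁺¹ = curry⁻¹ ∘ D(Dᵐ)`). [folklore] -/
theorem iteratedFDeriv_homogeneous (Φ : E → F) (d : ℤ)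
    (hΦ : ∀ c : ℝ, 0 < c → ∀ z, Φ (c • z) = c ^ d • Φ z) :
    ∀ (m : ℕ) (c : ℝ), 0 < c → ∀ z, iteratedFDeriv ℝ m Φ (c • z) = c ^ (d - m) • iteratedFDeriv ℝ m Φ z := by
  intro m
  induction m with
  | zero =>
    intro c hc z
    rw [iteratedFDeriv_zero_eq_comp, Function.comp_apply, Function.comp_apply, hΦ c hc z,
      LinearIsometryEquiv.map_smul]
    simp
  | succ m ih =>
    intro c hc z
    have hg : ∀ c : ℝ, 0 < c → ∀ z, iteratedFDeriv ℝ m Φ (c • z) = c ^ (d - m) • iteratedFDeriv ℝ m Φ z := ih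
    have hD := fderiv_homogeneous (iteratedFDeriv ℝ m Φ) (d - m) hg c hc z
    rw [iteratedFDeriv_succ_eq_comp_left, Function.comp_apply, Function.comp_apply, hD,
      LinearIsometryEquiv.map_smul]
    congr 1
    push_cast
    ring_nf

/-- **Bounds for the iterated derivatives of a homogeneous function smooth off the origin**
(finite-dimensional `E`): `‖DᵐΦ(z)‖ ≤ C(m) ‖z‖^{d−m}` for `z ≠ 0`, with
`C(m) = sup_{|w|=1} ‖DᵐΦ(w)‖`. [folklore] -/
theorem exists_norm_iteratedFDeriv_le_of_homogeneous [FiniteDimensional ℝ E] (Φ : E → F) (d : ℤ)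
    (hΦ : ∀ c : ℝ, 0 < c → ∀ z, Φ (c • z) = c ^ d • Φ z) (hs : ContDiffOn ℝ ∞ Φ {0}ᶜ) (m : ℕ) :
    ∃ C : ℝ, 0 ≤ C ∧ ∀ z : E, z ≠ 0 → ‖iteratedFDeriv ℝ m Φ z‖ ≤ C * ‖z‖ ^ (d - m) := by
  -- continuity of `DᵐΦ` on the unit sphere
  have hopen : IsOpen ({0}ᶜ : Set E) := isOpen_compl_singleton
  have hcont : ContinuousOn (iteratedFDeriv ℝ m Φ) {0}ᶜ := by
    have := hs.continuousOn_iteratedFDerivWithin (m := m) (by exact_mod_cast le_top) hopen.uniqueDiffOn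
    exact this.congr fun z hz => (iteratedFDerivWithin_of_isOpen m hopen hz).symm
  have hsph : sphere (0 : E) 1 ⊆ ({0}ᶜ : Set E) := fun w hw h0 => by
    rw [mem_singleton_iff] at h0
    rw [h0, mem_sphere_zero_iff_norm, norm_zero] at hw
    exact zero_ne_one hw
  obtain ⟨M, hM⟩ := (isCompact_sphere (0 : E) 1).exists_bound_of_continuousOn (hcont.mono hsph)
  refine ⟨max M 0, le_max_right _ _, fun z hz => ?_⟩
  have hr : 0 < ‖z‖ := norm_pos_iff.2 hz
  set w : E := ‖z‖⁻¹ • z with hw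
  have hw1 : ‖w‖ = 1 := by rw [hw, norm_smul, norm_inv, norm_norm, inv_mul_cancel₀ hr.ne']
  have hzw : z = ‖z‖ • w := by rw [hw, smul_smul, mul_inv_cancel₀ hr.ne', one_smul]
  have key := iteratedFDeriv_homogeneous Φ d hΦ m ‖z‖ hr w
  rw [← hzw] at key
  rw [key, norm_smul, Real.norm_eq_abs, abs_of_pos (zpow_pos hr _), mul_comm]
  exact mul_le_mul_of_nonneg_right ((hM w (mem_sphere_zero_iff_norm.2 hw1)).trans (le_max_left _ _))
    (zpow_pos hr _).le

end Homogeneous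

end Literature.Analysis.FluidPDE

end
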